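import Mathlib
import HarnessLib
import Summits.NavierStokesRegularity.NavierStokesRegularity.Theorems.PoloidalWindowDoorPoloidalWindowRigiditySparseEnergyScaledEnergy

/-!
# Route `PoloidalWindowDoor`, crux `PoloidalWindowRigidity` (stmt-19708), line `sparse_energy` — S1 UP TO THE APEX:
# the total past dissipation in every ball is bounded linearly in the radius

Seat ns-poloidal-K2-p2 g10 (LEAD-lineage on 19708; file `--supports`).  S1 (`…SparseEnergyScaledEnergy.scaledEnergy`) bounds
`∫⁻_{t<t₀} ∫⁻_{B_R(a)} |∇v|² ≤ K·R` for every `t₀ < 0` with ONE constant `K`; exhausting `(−∞,0)` by `(−∞,−1/(n+1))`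
(`setLIntegral_iUnion_of_directed`, no measurability) gives the bound for the whole past up to the apex time:
`∫⁻_{t<0} ∫⁻_{B_R(a)} |∇v(t,x)|² dx dt ≤ K·R` (`scaledDissipation_apex`) — the scaled dissipation `E(R)` of the CKN theory at the apex itself.

WHAT THIS IS NOT: not a claim about Navier–Stokes regularity; an a-priori estimate for hypothetical Type-I ancient profiles (bears_on LADDER-NS N0
via crux 19708, line sparse_energy). [folklore]
-/

noncomputable section

-- the summit and its single sub-problem share the name (CONVENTIONS §1), as in every Theorems file
set_option linter.dupNamespace false

namespace Summit.NavierStokesRegularity.NavierStokesRegularity.Theorems.PoloidalWindowDoorPoloidalWindowRigiditySparseEnergyScaledApex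

open MeasureTheory Set Function Filter Topology Metric
open scoped ENNReal
open Literature.Analysis Literature.Analysis.FluidPDE
open Summit.NavierStokesRegularity.NavierStokesRegularity.Theorems.PoloidalWindowDoorPoloidalWindowRigiditySparseEnergyScaledEnergy

variable {C : ℝ} {v : ℝ → EuclideanSpace ℝ (Fin 3) → EuclideanSpace ℝ (Fin 3)}

/-- `(−∞, 0) = ⋃ₙ (−∞, −1/(n+1))`, a directed union. [folklore] -/
theorem Iio_zero_eq_iUnion : Iio (0 : ℝ) = ⋃ n : ℕ, Iio (-((n : ℝ) + 1)⁻¹) := by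
  ext t
  simp only [mem_iUnion, mem_Iio]
  constructor
  · intro ht
    have hnt : 0 < -t := neg_pos.2 ht
    obtain ⟨n, hn⟩ := exists_nat_gt (1 / (-t))
    refine ⟨n, ?_⟩
    have : ((n : ℝ) + 1)⁻¹ < -t := by
      rw [inv_lt_comm₀ (by positivity) hnt, inv_eq_one_div]
      linarith
    linarith
  · rintro ⟨n, hn⟩
    exact hn.trans (by rw [neg_lt_zero]; positivity)

/-- **S1 UP TO THE APEX.**  For a profile of the route's Type-I class there is `K ≥ 0` with, for every centre `a` and radius `R > 0`:
the slice energies `∫⁻_{B_R(a)} |v(t₀)|² ≤ K·R` (`t₀ < 0`), the past dissipations `∫⁻_{t<t₀}∫⁻_{B_R(a)} |∇v|² ≤ K·R` (`t₀ < 0`), AND the total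
past dissipation up to the apex time `∫⁻_{t<0} ∫⁻_{B_R(a)} |∇v(t,x)|² dx dt ≤ K·R`. [folklore] -/
theorem scaledDissipation_apex (hrate : HasTypeITimeDecay C v)
    (hcont : ContinuousOn (uncurry v) (Iio (0 : ℝ) ×ˢ univ))
    (hmild : ∀ s t : ℝ, s < t → t < 0 → ∀ x,
      v t x = UnboundedOperators.heatExtension (v s) (t - s) x - oseenDuhamel 1 s v v t x)
    (hdiv : ∀ t < 0, VectorCalculus.IsDivFree (v t)) :
    ∃ K : ℝ, 0 ≤ K ∧
      (∀ t₀ < 0, ∀ (a : EuclideanSpace ℝ (Fin 3)) (R : ℝ), 0 < R →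
        (∫⁻ x in ball a R, ENNReal.ofReal (‖v t₀ x‖ ^ 2)) ≤ ENNReal.ofReal (K * R) ∧
        (∫⁻ t in Iio t₀, ∫⁻ x in ball a R, ENNReal.ofReal (‖fderiv ℝ (v t) x‖ ^ 2)) ≤ ENNReal.ofReal (K * R)) ∧
      ∀ (a : EuclideanSpace ℝ (Fin 3)) (R : ℝ), 0 < R →
        (∫⁻ t in Iio (0 : ℝ), ∫⁻ x in ball a R, ENNReal.ofReal (‖fderiv ℝ (v t) x‖ ^ 2)) ≤ ENNReal.ofReal (K * R) := by
  obtain ⟨K, hK0, hK⟩ := scaledEnergy hrate hcont hmild hdiv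
  refine ⟨K, hK0, hK, fun a R hR => ?_⟩
  have hdir : Directed (· ⊆ ·) fun n : ℕ => Iio (-((n : ℝ) + 1)⁻¹) := by
    refine Monotone.directed_le fun m n hmn => Iio_subset_Iio ?_
    have : ((n : ℝ) + 1)⁻¹ ≤ ((m : ℝ) + 1)⁻¹ := by
      apply inv_anti₀ (by positivity)
      exact_mod_cast Nat.succ_le_succ hmn
    linarith
  rw [Iio_zero_eq_iUnion, setLIntegral_iUnion_of_directed _ hdir]
  exact iSup_le fun n => (hK _ (by rw [neg_lt_zero]; positivity) a R hR).2

end Summit.NavierStokesRegularity.NavierStokesRegularity.Theorems.PoloidalWindowDoorPoloidalWindowRigiditySparseEnergyScaledApex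

end
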